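import Literature.Barriers.CriticalPhenomena.TimarHeavyCriticalClustersProofs
import Literature.Barriers.CriticalPhenomena.TimarFiniteLevelUnionCut
import Literature.Barriers.CriticalPhenomena.TimarNoLightClustersFirstMoment
import HarnessLib

/-!
# Discharge of Timár 2006, Cor. 5.7 (heavy half and as printed) and Cor. 5.6

`Timar2006_notInfinitelyManyHeavyCriticalClusters` (`TimarCriticalNonunimodular.lean`): on a
connected, locally finite, transitive, nonunimodular graph, critical Bernoulli bond percolation
a.s. does not have infinitely many heavy infinite clusters. The printed proof (Á. Timár,
*Percolation on nonunimodular transitive graphs*, Ann. Probab. 34 (2006) 2344–2364, proof of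
Cor. 5.7, p. 2361) is: Thm. 5.5 (two heavy clusters have infinite pieces in one connected finite
union of levels) + quasi-transitivity and unimodularity of the level-preserving automorphisms on a
finite union of levels (§2, p. 2347) + the unimodular theorem "infinitely many infinite clusters
⟹ `p_c < 1`" [BLPS 1999]. The whole glue is the tree theorem
`Timar2006_notInfinitelyManyHeavyCriticalClusters_of_finiteLevelUnion`
(`TimarHeavyCriticalClustersProofs.lean`, with `MassTransportPrincipleSubgroup`,
`UnimodularSubgroup`, `TimarLevelComponents`, `TimarHeavyClustersErgodic`); this leaf file feeds
it the discharge of Thm. 5.5 (`Timar2006_finiteLevelUnion_holds`, `TimarFiniteLevelUnionCut.lean`).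

With Thm. 4.3 also discharged (`Timar2006_noInfiniteLightClusters_holds`,
`TimarNoLightClustersFirstMoment.lean`), the printed Cor. 5.7
(`Timar2006_notInfinitelyManyCriticalClusters`) follows by
`Timar2006_notInfinitelyManyCriticalClusters_of_theorems`, and Cor. 5.6
(`Timar2006_levelUnion_infinitelyManyClusters`) by
`Timar2006_levelUnion_infinitelyManyClusters_of_finiteLevelUnion`. All three discharges are
one-line applications of landed theorems; nothing new is stated.

## References
* Á. Timár, Ann. Probab. 34 (2006) 2344–2364 (arXiv:math/0702875), Thm. 4.3, Thm. 5.5, Cor. 5.6,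
  Cor. 5.7. [Timar2006]
* I. Benjamini, R. Lyons, Y. Peres, O. Schramm, *Critical percolation on any nonamenable group has
  no infinite clusters*, Ann. Probab. 27 (1999) 1347–1356; *Group-invariant percolation on graphs*,
  GAFA 9 (1999) 29–66. [BLPS1999]
* R. Lyons, Y. Peres, *Probability on Trees and Networks*, CUP 2016, Thm. 8.21, Exercise 8.8.
  [LyonsPeres2016]
-/

namespace Literature.Barriers.CriticalPhenomena

/-- DISCHARGE of `Timar2006_notInfinitelyManyHeavyCriticalClusters` — Timár's Cor. 5.7 for heavy
clusters: from Thm. 5.5 (`Timar2006_finiteLevelUnion_holds`) through the proved glue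
`Timar2006_notInfinitelyManyHeavyCriticalClusters_of_finiteLevelUnion`.
[cite: Timar2006, Cor. 5.7 (proof, p. 2361) and Thm. 5.5] -/
theorem Timar2006_notInfinitelyManyHeavyCriticalClusters_holds :
    Timar2006_notInfinitelyManyHeavyCriticalClusters :=
  Timar2006_notInfinitelyManyHeavyCriticalClusters_of_finiteLevelUnion
    Timar2006_finiteLevelUnion_holds

/-- DISCHARGE of `Timar2006_notInfinitelyManyCriticalClusters` — Timár's Cor. 5.7 as printed
("at critical probability `p_c` there cannot be infinitely many infinite clusters"): from
Thm. 4.3 (`Timar2006_noInfiniteLightClusters_holds`) and Thm. 5.5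
(`Timar2006_finiteLevelUnion_holds`) through `Timar2006_notInfinitelyManyCriticalClusters_of_theorems`.
[cite: Timar2006, Cor. 5.7 (proof, p. 2361)] -/
theorem Timar2006_notInfinitelyManyCriticalClusters_holds :
    Timar2006_notInfinitelyManyCriticalClusters :=
  Timar2006_notInfinitelyManyCriticalClusters_of_theorems
    Timar2006_noInfiniteLightClusters_holds Timar2006_finiteLevelUnion_holds

/-- DISCHARGE of `Timar2006_levelUnion_infinitelyManyClusters` — Timár's Cor. 5.6: from Thm. 5.5
(`Timar2006_finiteLevelUnion_holds`) through the proved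
`Timar2006_levelUnion_infinitelyManyClusters_of_finiteLevelUnion`.
[cite: Timar2006, Cor. 5.6 (proof, p. 2360)] -/
theorem Timar2006_levelUnion_infinitelyManyClusters_holds :
    Timar2006_levelUnion_infinitelyManyClusters :=
  Timar2006_levelUnion_infinitelyManyClusters_of_finiteLevelUnion Timar2006_finiteLevelUnion_holds

end Literature.Barriers.CriticalPhenomena
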